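import Summits.Ventures.PercRepro.Night2ExcessMassIndep

/-!
# PercRepro — the middle-target capacity through the FAT covering preimages (night-2, gen 24)

The count assembly `localShadowHall_excess_of_count` (gen 21) bounds the residual capacity of a middle target `S`
(`|S ∖ K| ≥ ρ + 1`) by `c′ = cPrimeDGP = capDG − (ρ − 2)·Φ/(m₁ + d)`: every one of its `≤ ρ − 2` thin covering
preimages is charged the maximal request `Φ/(2 + d)` (`m₁ = 2`).  In the `(3, 1)` survivor cells the fat thin
closures are few (one pair, two disjoint pairs, a triangle), and a middle target has at most `f` FAT thin covering
preimages (`f = 1` / `2`): the other preimages miss `≥ 3` points and request `≤ Φ/(3 + d)`.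

* `cPrimeFat q d ρ k f = capDG − f·Φ/(2+d) − (ρ − 2 − f)·Φ/(3+d)` — at `(3, 1)`: `31/360` (`f = 1`), `17/360` (`f = 2`)
  against the old `1/120`;
* **`L1_le_of_fat_le`**: `L1 S ≤ f·Φ/(2+d) + (ρ − 2 − f)·Φ/(3+d)` at a middle target with `≤ f` fat thin preimages;
* **`cap2_ge_cPrimeFat`**: `cap2 S ≥ cPrimeFat`;
* **`localShadowHall_excess_of_count_fat`**: the count assembly with `cPrimeFat` in the count sum — the proof of
  `localShadowHall_excess_of_count` with the one bound exchanged.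
-/

namespace PercRepro.Shadow

open Finset PerFlat ThmH

/-- The middle-target capacity with `f` fat preimages: `capDG − f·Φ/(2+d) − (ρ − 2 − f)·Φ/(3+d)`. -/
noncomputable def cPrimeFat (q d ρ k f : ℕ) : ℚ :=
  capDG q d k - (f : ℚ) * reqDGP q d 2 - ((ρ : ℚ) - 2 - f) * reqDGP q d 3

/-- `cPrimeFat 5 3 5 1 1 = 31 / 360` — the cell `(3, 1)` with one fat closure. -/
theorem cPrimeFat_three_one_one : cPrimeFat 5 3 5 1 1 = (31 / 360 : ℚ) := by
  unfold cPrimeFat capDG reqDGP phiQ; norm_num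

/-- `cPrimeFat 5 3 5 1 2 = 17 / 360` — the cell `(3, 1)` with two fat preimages per target. -/
theorem cPrimeFat_three_one_two : cPrimeFat 5 3 5 1 2 = (17 / 360 : ℚ) := by
  unfold cPrimeFat capDG reqDGP phiQ; norm_num

variable {α : Type*} [DecidableEq α] {M : Matroid α} [M.Finite]

/-- `reqDGP q d 3 ≤ reqDGP q d 2`: the request decreases with the number of missed points. -/
theorem reqDGP_three_le_two (q d : ℕ) : reqDGP q d 3 ≤ reqDGP q d 2 := by
  unfold reqDGP phiQ
  apply div_le_div_of_nonneg_left (by positivity) (by positivity)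
  push_cast; linarith

/-- `0 ≤ reqDGP q d m`. -/
theorem reqDGP_nonneg (q d m : ℕ) : 0 ≤ reqDGP q d m := by
  unfold reqDGP phiQ; positivity

open scoped Classical in
/-- **`L1 S ≤ f·Φ/(2+d) + (ρ − 2 − f)·Φ/(3+d)` at a middle target with at most `f` fat thin covering preimages**:
the `≤ ρ − 2` thin covering preimages of `S` request `≤ Φ/(2+d)` when fat and `≤ Φ/(3+d)` otherwise. -/
theorem L1_le_of_fat_le {q d ρ f : ℕ} {G : Finset α} (hG : G ∈ flatsQ M (q + 1))
    (hd : (gr M \ G).card = d) (hdq : d ≤ q) (hk : kColoops M G + ρ = q + 1)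
    (hs : ∀ e ∈ gr M, ∀ f ∈ gr M, e ≠ f → rkN M {e, f} = 2) (hl : ∀ e ∈ gr M, M.Indep {e}) {S : Finset α}
    (hS : S ∈ shadowAt M (q + 2) q (Uq M (q + 2) q) G) (hcard : ρ + 1 ≤ (S \ coloops M G).card)
    (hf : ((coverPreimages M (Uq M (q + 2) q) G S).filter
      (fun B => B ∉ lay0 M q G ∧ (G \ clF M B).card ≤ 2)).card ≤ f) :
    L1 M q G S ≤ (f : ℚ) * reqDGP q d 2 + ((ρ : ℚ) - 2 - f) * reqDGP q d 3 := by
  have hd' : (gr M \ G).card ≤ q := by omega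
  unfold L1
  set P := (coverPreimages M (Uq M (q + 2) q) G S).filter (fun B => B ∉ lay0 M q G) with hP
  have hthin : ∀ B ∈ P, B ∈ thinMembers M q G := by
    intro B hB
    rw [hP, Finset.mem_filter, mem_coverPreimages] at hB
    exact mem_thinMembers.2 ⟨hB.1.1, hB.2⟩
  -- split into the fat and the non-fat preimages
  rw [← Finset.sum_filter_add_sum_filter_not P (fun B => (G \ clF M B).card ≤ 2)]
  have hFcard : (P.filter (fun B => (G \ clF M B).card ≤ 2)).card ≤ f := by
    rw [hP, Finset.filter_filter]; exact hf
  have hPcard := card_thin_coverPreimages_add_two_le hG hd' hk hs hl hS hcard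
  rw [← hP] at hPcard
  have hsplit := Finset.card_filter_add_card_filter_not (s := P) (fun B => (G \ clF M B).card ≤ 2)
  have hfat : ∑ B ∈ P.filter (fun B => (G \ clF M B).card ≤ 2), req M q B ≤
      ((P.filter (fun B => (G \ clF M B).card ≤ 2)).card : ℚ) * reqDGP q d 2 := by
    rw [← nsmul_eq_mul, ← Finset.sum_const]
    apply Finset.sum_le_sum
    intro B hB
    rw [Finset.mem_filter] at hB
    have hBt := hthin B hB.1
    have h2 : 2 ≤ (G \ clF M B).card :=
      two_le_card_sdiff_of_not_lay0 hG hd' (mem_thinMembers.1 hBt).1 (mem_thinMembers.1 hBt).2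
    unfold reqDGP
    exact req_le_of_spread hG hd hBt h2
  have hnot : ∑ B ∈ P.filter (fun B => ¬ (G \ clF M B).card ≤ 2), req M q B ≤
      ((P.filter (fun B => ¬ (G \ clF M B).card ≤ 2)).card : ℚ) * reqDGP q d 3 := by
    rw [← nsmul_eq_mul, ← Finset.sum_const]
    apply Finset.sum_le_sum
    intro B hB
    rw [Finset.mem_filter] at hB
    have hBt := hthin B hB.1
    have h3 : 3 ≤ (G \ clF M B).card := by omega
    unfold reqDGP
    exact req_le_of_spread hG hd hBt h3
  have hR := reqDGP_three_le_two q d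
  have hR3 := reqDGP_nonneg q d 3
  set a := (P.filter (fun B => (G \ clF M B).card ≤ 2)).card with ha
  set b := (P.filter (fun B => ¬ (G \ clF M B).card ≤ 2)).card with hb
  have haf : (a : ℚ) ≤ f := by exact_mod_cast hFcard
  have hab : (a : ℚ) + b + 2 ≤ ρ := by
    have : a + b + 2 ≤ ρ := by omega
    exact_mod_cast this
  calc ∑ B ∈ P.filter (fun B => (G \ clF M B).card ≤ 2), req M q B +
        ∑ B ∈ P.filter (fun B => ¬ (G \ clF M B).card ≤ 2), req M q B
      ≤ (a : ℚ) * reqDGP q d 2 + (b : ℚ) * reqDGP q d 3 := add_le_add hfat hnot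
    _ = (a : ℚ) * (reqDGP q d 2 - reqDGP q d 3) + ((a : ℚ) + b) * reqDGP q d 3 := by ring
    _ ≤ (f : ℚ) * (reqDGP q d 2 - reqDGP q d 3) + ((ρ : ℚ) - 2) * reqDGP q d 3 := by
        apply add_le_add
        · exact mul_le_mul_of_nonneg_right haf (by linarith)
        · exact mul_le_mul_of_nonneg_right (by linarith) hR3
    _ = (f : ℚ) * reqDGP q d 2 + ((ρ : ℚ) - 2 - f) * reqDGP q d 3 := by ring

open scoped Classical in
/-- **`cap2 S ≥ cPrimeFat`** at a middle target with at most `f` fat thin covering preimages. -/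
theorem cap2_ge_cPrimeFat {q d ρ f : ℕ} {G : Finset α} (hG : G ∈ flatsQ M (q + 1))
    (hd : (gr M \ G).card = d) (hdq : d ≤ q) (hk : kColoops M G + ρ = q + 1)
    (hs : ∀ e ∈ gr M, ∀ f ∈ gr M, e ≠ f → rkN M {e, f} = 2) (hl : ∀ e ∈ gr M, M.Indep {e}) {S : Finset α}
    (hS : S ∈ shadowAt M (q + 2) q (Uq M (q + 2) q) G) (hcard : ρ + 1 ≤ (S \ coloops M G).card)
    (hf : ((coverPreimages M (Uq M (q + 2) q) G S).filter
      (fun B => B ∉ lay0 M q G ∧ (G \ clF M B).card ≤ 2)).card ≤ f) :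
    cPrimeFat q d ρ (kColoops M G) f ≤ cap2 M q G S := by
  have hd' : (gr M \ G).card ≤ q := by omega
  unfold cPrimeFat
  have h1 := cap2_ge_capS_sub_L1_of_le hG hd' S
  have h2 := capS_ge_one_sub_kColoops (q := q) hd (subset_G_of_mem_shadowAt hS)
  have h3 := L1_le_of_fat_le hG hd hdq hk hs hl hS hcard hf
  unfold capDG
  linarith

/-- **THE ASSEMBLY WITH A COUNT OF THE COVERING BASES AND THE FAT-FACE CAPACITY**: `localShadowHall_excess_of_count`
with the middle-target capacity `cPrimeFat q d ρ k f` in place of `cPrimeDGP`: if every middle target `S`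
(`|S ∖ K| ≥ ρ + 1`) has at most `f` thin covering preimages missing `≤ 2` points, (LI_G) holds as soon as
`countSum n ρ (q − d + 1) (cPrimeFat q d ρ k f) E cnt ≥ 1`.  The bases-only hypotheses (`0 ≤ cPrimeDGP`, `hm₁`) are
kept: they make the big thin members lossless. -/
theorem localShadowHall_excess_of_count_fat {q d ρ m₁ f : ℕ} {G : Finset α} (hG : G ∈ flatsQ M (q + 1))
    (hd : (gr M \ G).card = d) (hdq : d ≤ q) (hk : kColoops M G + ρ = q + 1) (hρ : 3 ≤ ρ)
    (hs : ∀ e ∈ gr M, ∀ f ∈ gr M, e ≠ f → rkN M {e, f} = 2)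
    (hl : ∀ e ∈ gr M, M.Indep {e}) (hc : 0 ≤ cPrimeDGP q d ρ (kColoops M G) m₁)
    (hm₁ : ∀ B ∈ thinMembers M q G, ρ ≤ (B \ coloops M G).card → m₁ ≤ (G \ clF M B).card)
    (hcf : 0 ≤ cPrimeFat q d ρ (kColoops M G) f)
    (hfat : ∀ S ∈ shadowAt M (q + 2) q (Uq M (q + 2) q) G, ρ + 1 ≤ (S \ coloops M G).card →
      ((coverPreimages M (Uq M (q + 2) q) G S).filter
        (fun B => B ∉ lay0 M q G ∧ (G \ clF M B).card ≤ 2)).card ≤ f)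
    {E : ℚ} (hE : 0 < E)
    (hTE : ∀ S : Finset α, S ⊆ G → ∀ T ∈ coverBases M G S ρ,
      ∑ w ∈ T, faceLoss M q G (coloops M G ∪ T) w ≤ E)
    {cnt : ℕ → ℚ} (hcpos : ∀ s, ρ + 1 ≤ s → s ≤ G.card - kColoops M G → 0 < cnt s)
    (hcnt : ∀ S : Finset α, S ⊆ G → ((coverBases M G S ρ).card : ℚ) ≤ cnt (S \ coloops M G).card)
    (hsum : 1 ≤ countSum (G.card - kColoops M G) ρ (q - d + 1) (cPrimeFat q d ρ (kColoops M G) f) E cnt) :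
    LocalShadowHall M q G := by
  have hd' : (gr M \ G).card ≤ q := by omega
  have hKG : coloops M G ⊆ G := fun y hy => (mem_coloops.1 hy).1
  apply localShadowHall_of_lossFair hG hd'
  intro B hB z hz
  by_cases hl0 : loss M q G B z = 0
  · rw [hl0]
    exact mul_nonneg (rhoL_nonneg hG hd' B z) (lossIncome_nonneg hG hd' B z)
  have hB' : B ∈ membersIn M (Uq M (q + 2) q) G := (mem_thinMembers.1 hB).1
  have hBU : B ∈ Uq M (q + 2) q := (mem_membersIn.1 hB').1
  have hzB : z ∉ B := notMem_of_notMem_clF hBU (Finset.mem_sdiff.1 hz).2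
  have hK := coloops_subset_of_mem_thinMembers hG hd' hB
  have h2 : (B \ coloops M G).card + 1 = ρ := by
    by_contra hne
    have hge := card_sdiff_coloops_thin_ge hG hd' hk hB
    exact hl0 (loss_eq_zero_of_card_ge_dgenP hG hd hdq hk hc hs hl hm₁ hB (by omega) hz)
  set n := G.card - kColoops M G with hn
  have hr : (G \ insert z B).card = n - ρ := card_sdiff_insert_eq_dqm1 hG hd' hB h2 hz
  have hr1 : 1 ≤ n - ρ := by rw [← hr]; exact one_le_card_sdiff_insert hG hd' hB hz
  have hBcard : B.card = kColoops M G + (B \ coloops M G).card := by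
    rw [kColoops_eq_card_coloops, ← Finset.card_union_of_disjoint Finset.disjoint_sdiff,
      Finset.union_sdiff_of_subset hK]
  have hb' : (insert z B).card = q + 1 := by rw [Finset.card_insert_of_notMem hzB, hBcard]; omega
  have hT : (tgtSets M q G B z).card = 2 ^ (n - ρ) - 1 := by rw [card_tgtSets hG hB' hz, hr]
  have hTpos : (0 : ℚ) < ((2 ^ (n - ρ) - 1 : ℕ) : ℚ) := by
    have : 2 ≤ 2 ^ (n - ρ) := by
      calc 2 = 2 ^ 1 := by norm_num
        _ ≤ 2 ^ (n - ρ) := Nat.pow_le_pow_right (by norm_num) hr1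
    exact_mod_cast (by omega : 0 < 2 ^ (n - ρ) - 1)
  have hGcard : G.card = n + kColoops M G := by
    have : kColoops M G ≤ G.card := by
      rw [kColoops_eq_card_coloops]
      exact Finset.card_le_card hKG
    omega
  set u : ℕ → ℚ := fun s => cnt (s - kColoops M G) * (E / ((2 ^ (n - ρ) - 1 : ℕ) : ℚ)) with hu_def
  set v : ℕ → ℚ := fun s => if s + (q - d + 1) ≤ G.card then cPrimeFat q d ρ (kColoops M G) f else 1 with hv_def
  have hKS : ∀ S ∈ tgtSets M q G B z, coloops M G ⊆ S :=
    fun S hS => coloops_subset_of_mem_shadowAt (mem_tgtSets.1 hS).1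
  have hSK : ∀ S ∈ tgtSets M q G B z, (S \ coloops M G).card = S.card - kColoops M G := by
    intro S hS
    rw [Finset.card_sdiff_of_subset (hKS S hS), kColoops_eq_card_coloops]
  have hρ1 : ∀ S ∈ tgtSets M q G B z, ρ + 1 ≤ (S \ coloops M G).card := by
    intro S hS
    obtain ⟨-, hBS, hcard⟩ := mem_tgtSets.1 hS
    have hBS' : B ⊆ S := (Finset.subset_insert z B).trans hBS
    have hsub : (S \ B) ∪ (B \ coloops M G) ⊆ S \ coloops M G := by
      intro x hx
      rw [Finset.mem_union, Finset.mem_sdiff, Finset.mem_sdiff] at hx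
      rw [Finset.mem_sdiff]
      rcases hx with ⟨hxS, hxB⟩ | ⟨hxB, hxK⟩
      · exact ⟨hxS, fun h => hxB (hK h)⟩
      · exact ⟨hBS' hxB, hxK⟩
    have hdisj : Disjoint (S \ B) (B \ coloops M G) := by
      rw [Finset.disjoint_left]; intro x hx hx'
      exact (Finset.mem_sdiff.1 hx).2 (Finset.mem_sdiff.1 hx').1
    have := Finset.card_le_card hsub
    rw [Finset.card_union_of_disjoint hdisj] at this
    omega
  have hρ0 : (0 : ℚ) < (ρ : ℚ) := by exact_mod_cast (by omega : 0 < ρ)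
  have hu : ∀ S ∈ tgtSets M q G B z, pi2Mass M q G S ≤ u S.card := by
    intro S hS
    have hSG : S ⊆ G := subset_G_of_mem_shadowAt (mem_tgtSets.1 hS).1
    have hmass := pi2Mass_le_excess_indep hG hd hdq hk hc hs hl hm₁ S (hTE S hSG)
    have hcntS := hcnt S hSG
    rw [hSK S hS] at hcntS
    have hED : 0 ≤ E / ((2 ^ (n - ρ) - 1 : ℕ) : ℚ) := div_nonneg hE.le hTpos.le
    simp only [hu_def]
    calc pi2Mass M q G S ≤ ((coverBases M G S ρ).card : ℚ) * (E / ((2 ^ (n - ρ) - 1 : ℕ) : ℚ)) := hmass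
      _ ≤ cnt (S.card - kColoops M G) * (E / ((2 ^ (n - ρ) - 1 : ℕ) : ℚ)) :=
          mul_le_mul_of_nonneg_right hcntS hED
  have hv : ∀ S ∈ tgtSets M q G B z, v S.card ≤ cap2 M q G S := by
    intro S hS
    have hS' := (mem_tgtSets.1 hS).1
    have hSG : S ⊆ G := subset_G_of_mem_shadowAt hS'
    simp only [hv_def]
    split_ifs with hle
    · exact cap2_ge_cPrimeFat hG hd hdq hk hs hl hS' (hρ1 S hS) (hfat S hS' (hρ1 S hS))
    · push Not at hle
      have h1 : (G \ S).card ≤ q - d := by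
        rw [Finset.card_sdiff_of_subset hSG]; omega
      exact (cap2_eq_one_of_card_le hG (by rw [hd]; omega)).ge
  have hv0 : ∀ S ∈ tgtSets M q G B z, 0 ≤ v S.card := by
    intro S _
    simp only [hv_def]
    split_ifs
    · exact hcf
    · exact zero_le_one
  have hinc := lossIncome_ge_of_bounds hG hd' hB hz hl0 u v hu hv hv0
  rw [hr, hb'] at hinc
  have hsum' : ∑ j ∈ Finset.Icc 1 (n - ρ), ((n - ρ).choose j : ℚ) * (v (q + 1 + j) / u (q + 1 + j)) =
      ((2 ^ (n - ρ) - 1 : ℕ) : ℚ) * countSum n ρ (q - d + 1) (cPrimeFat q d ρ (kColoops M G) f) E cnt := by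
    unfold countSum
    rw [Finset.mul_sum]
    apply Finset.sum_congr rfl
    intro j hj
    rw [Finset.mem_Icc] at hj
    have hv' : v (q + 1 + j) = DGenP.cjG n ρ (q - d + 1) j (cPrimeFat q d ρ (kColoops M G) f) := by
      simp only [hv_def, DGenP.cjG]
      have hiff : q + 1 + j + (q - d + 1) ≤ G.card ↔ j + ρ + (q - d + 1) ≤ n := by omega
      by_cases hcj : j + ρ + (q - d + 1) ≤ n
      · rw [if_pos (hiff.2 hcj), if_pos hcj]
      · rw [if_neg (fun h => hcj (hiff.1 h)), if_neg hcj]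
    have hu' : u (q + 1 + j) = cnt (j + ρ) * (E / ((2 ^ (n - ρ) - 1 : ℕ) : ℚ)) := by
      simp only [hu_def]
      rw [show q + 1 + j - kColoops M G = j + ρ by omega]
    rw [hv', hu']
    have hjρ : (0 : ℚ) < cnt (j + ρ) := hcpos (j + ρ) (by omega) (by omega)
    field_simp
  rw [hsum'] at hinc
  unfold rhoL
  rw [hT]
  have hl' : 0 < loss M q G B z := lt_of_le_of_ne (loss_nonneg' hG hd' B z) (Ne.symm hl0)
  calc loss M q G B z = loss M q G B z / ((2 ^ (n - ρ) - 1 : ℕ) : ℚ) * ((2 ^ (n - ρ) - 1 : ℕ) : ℚ) := by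
        field_simp
    _ ≤ loss M q G B z / ((2 ^ (n - ρ) - 1 : ℕ) : ℚ) *
          (((2 ^ (n - ρ) - 1 : ℕ) : ℚ) * countSum n ρ (q - d + 1) (cPrimeFat q d ρ (kColoops M G) f) E cnt) := by
        apply mul_le_mul_of_nonneg_left _ (div_nonneg hl'.le hTpos.le)
        nlinarith [hsum, hTpos]
    _ ≤ loss M q G B z / ((2 ^ (n - ρ) - 1 : ℕ) : ℚ) * lossIncome M q G B z :=
        mul_le_mul_of_nonneg_left hinc (div_nonneg hl'.le hTpos.le)


end PercRepro.Shadow
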